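import Summits.QuantumFields.YangMills.Theorems.AllWindowsColdBoxBoxHighLineActionSandwichSharp

/-!
# U5-L5 (i) BY NAME: `actionSandwichSharp : ActionSandwichSharp` — the planner's typed Prop of `Cruxes/BoxWindowHighSU2213/TaskU5L5.lean` (VERBATIM)

Width seat `ym-line-sfw-p2-w2` (prover-ym-line-sfw-p2-w2-g32-0).  Planner ym-idea-2 g18 typed lift L5 (i) of `U5-BLOCKERS.md` (bus 2026-08-29T22:06:13Z
«L5 (i) → w2») as the Prop `ActionSandwichSharp` over the letter `edgeMass H a = Σ_e ‖a_e‖²`; both are copied here byte-for-byte from the crux task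
file (Theorems files cannot import `Cruxes/`), and the Prop is DISCHARGED by the def-free theorem ✓`abs_action_sub_boxQuadForm_le_sharp` of the
companion file `…ActionSandwichSharp` (`c₀ = 1`).

* `edgeMass` — `N(a) = Σ_e ‖a_e‖²` (task letter, verbatim);
* `ActionSandwichSharp` — `∃ C c₀, 0 < c₀ ∧ ∀ H ≥ 1, ∀ t ∈ [0, c₀], ∀ a (‖a_e‖ ≤ t), |S(U(a)) + Φ(U(a)) − boxQuadForm H a| ≤ C·t·(boxQuadForm H a + edgeMass H a)`
  (task Prop, verbatim);
* ★★ `actionSandwichSharp : ActionSandwichSharp`; `edgeMass_nonneg`.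

HONEST LABEL: the by-name record of an S/M support brick (U5 prep, helper) for lift L5 of the NEXT rung U5 (LINE-20 ⟨stmt-QuantumFields-24336⟩,
`stub_landauThirdOrder`; U5 UNSTAFFED, I23 open) of a critic-PASSed DRAFT line; T-S5.6′ `SmallFieldInsideFPSharp`, U5, ⟨24336⟩, ⟨24004⟩ remain OPEN;
no stub is closed by name; no crux, rung or summit is proved; **the Yang–Mills mass gap is NOT proved by this file; no summit is proved by a line.**
-/

set_option autoImplicit false

noncomputable section

open Matrix Finset

namespace Summit.QuantumFields.YangMills.Theorems.AllWindowsColdBoxBoxHighLine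

/-- The edge mass `N(a) = Σ_e ‖a_e‖²` (kept separate from `boxQuadForm` in the sharp sandwich).  [VERBATIM from `Cruxes/BoxWindowHighSU2213/TaskU5L5.lean`] -/
def edgeMass (H : ℕ) (a : LandauFree H → E3) : ℝ := ∑ e : LandauFree H, ‖a e‖ ^ 2

/-- **U5-L5 (i) = T-S5.6a′ `ActionSandwichSharp`** — on fields with all `‖a_e‖ ≤ t ≤ c₀`:
`|S(U(a)) + Φ(U(a)) − boxQuadForm H a| ≤ C·t·(boxQuadForm H a + Σ_e ‖a_e‖²)` — NO factor `H` (compare ✓`ActionSandwich`: `C·t·H·boxQuadForm`,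
hypothesis `t·H ≤ c₀`).  The two are incomparable pointwise; T-S5.6′ consumes this one.  [VERBATIM from `Cruxes/BoxWindowHighSU2213/TaskU5L5.lean`] -/
def ActionSandwichSharp : Prop :=
  ∃ C c₀ : ℝ, 0 < c₀ ∧ ∀ H : ℕ, 1 ≤ H → ∀ t : ℝ, 0 ≤ t → t ≤ c₀ → ∀ a : LandauFree H → E3, (∀ e, ‖a e‖ ≤ t) →
    |boxWilson H (edgeChart H a) + landauPhi H (edgeChart H a) - boxQuadForm H a| ≤ C * t * (boxQuadForm H a + edgeMass H a)

/-- Sanity: `edgeMass` is nonnegative. -/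
theorem edgeMass_nonneg (H : ℕ) (a : LandauFree H → E3) : 0 ≤ edgeMass H a :=
  Finset.sum_nonneg fun _ _ => by positivity

/-- ★★ **U5-L5 (i) BY NAME**: `ActionSandwichSharp` holds (`c₀ = 1`, `C = 458 + 16·max C_Φ 0` from ✓`abs_action_sub_boxQuadForm_le_sharp`). -/
theorem actionSandwichSharp : ActionSandwichSharp := by
  obtain ⟨C, hC, h⟩ := abs_action_sub_boxQuadForm_le_sharp
  exact ⟨C, 1, one_pos, fun H hH t ht0 ht1 a ha => h H hH t ht0 ht1 a ha⟩

end Summit.QuantumFields.YangMills.Theorems.AllWindowsColdBoxBoxHighLine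

end
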